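import Summits.AtomisticToContinuum.HydrodynamicLimit.Theorems.ImplosionDichotomyPolynomialCompressionCloseSupBounds
import Summits.AtomisticToContinuum.HydrodynamicLimit.Theorems.ImplosionDichotomyPolynomialCompressionIsentropicCalculus

/-!
# The improvement step of the bootstrap (closing of stub 4, part 3)

Helper file for the line `log-lipschitz-budget` of the crux `ImplosionDichotomy.PolynomialCompression`
(stmt-AtomisticToContinuum-12587), stub `stub_logBudgetShadowing`, blueprint §5 (the CLOSE): WEAK bounds
at a time `s` plus the level bounds `E_k(s) ≤ ℰ` improve to the STRONG bounds at `s`. Pointwise real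
algebra at an isentropic reference point (`ρ₁ = c³`, `θ₁ = Kc²`, `√θ₁ = √K c`, `L ≤ c ≤ U`): under the
weak bounds `|δρ| ≤ ρ₁/2`, `|δθ| ≤ θ₁/2` and the small-packing bounds `|ζ - 1|, |ρζ'| ≤ 1/8` the Friedrichs
weights are bounded below, `A ≥ K/(4U)`, `ρ ≥ L³/2`, `B ≥ L/(2K)` (`lbClose_point_facts`); then
`lbClose_sup_bounds` and the seven elementary smallness inequalities of `lbClose_smallness` give
`|δρ| ≤ ρ₁/4`, `|δθ| ≤ θ₁/4`, `ρσ³ ≤ ηs/2`, `‖δu‖ ≤ 1` and the three weighted gradient bounds with the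
STRONG constant `1/(2(T₁ - s))` (`lbClose_step`).
-/

noncomputable section

namespace Summit.AtomisticToContinuum.HydrodynamicLimit.Theorems

open Set MeasureTheory
open Literature.MathematicalPhysics.KineticTheory Literature.Analysis.FunctionSpaces

/-! ### Pointwise algebra -/

/-- **Weights at a point of the weak regime.** With `ρ₁ = c³`, `θ₁ = K c²`, `0 < L ≤ c ≤ U`,
`|ρ - ρ₁| ≤ ρ₁/2`, `|θ - θ₁| ≤ θ₁/2`, `|ζ - 1| ≤ 1/8`, `|ρ ζ'| ≤ 1/8`: `ρ ≥ L³/2`, `ρ ≤ (3/2)U³`,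
`A = θ(ζ + ρζ')/ρ ≥ K/(4U)`, `A ≤ 4K/L`, `B = (3/2)ρ/θ ≥ L/(2K)`. [folklore] -/
theorem lbClose_point_facts :
    ∀ {K L U c r₁ t₁ r t z dz : ℝ}, 0 < K → 0 < L → L ≤ c → c ≤ U → r₁ = c ^ 3 → t₁ = K * c ^ 2 →
      |r - r₁| ≤ r₁ / 2 → |t - t₁| ≤ t₁ / 2 → |z - 1| ≤ 1 / 8 → |r * dz| ≤ 1 / 8 →
      L ^ 3 / 2 ≤ r ∧ r ≤ 3 / 2 * U ^ 3 ∧ K / (4 * U) ≤ t * (z + r * dz) / r ∧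
        t * (z + r * dz) / r ≤ 4 * K / L ∧ L / (2 * K) ≤ 3 / 2 * r / t := by
  intro K L U c r₁ t₁ r t z dz hK hL hLc hcU hr₁ ht₁ hδr hδt hz hdz
  have hc : 0 < c := hL.trans_le hLc
  have hU : 0 < U := hc.trans_le hcU
  have hc2 : L ^ 2 ≤ c ^ 2 := pow_le_pow_left₀ hL.le hLc 2
  have hc3 : L ^ 3 ≤ c ^ 3 := pow_le_pow_left₀ hL.le hLc 3
  have hcU3 : c ^ 3 ≤ U ^ 3 := pow_le_pow_left₀ hc.le hcU 3
  have hr₁0 : 0 < r₁ := by rw [hr₁]; positivity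
  have ht₁0 : 0 < t₁ := by rw [ht₁]; positivity
  have hr1 : r₁ / 2 ≤ r := by linarith [(abs_le.1 hδr).1]
  have hr2 : r ≤ 3 / 2 * r₁ := by linarith [(abs_le.1 hδr).2]
  have ht1 : t₁ / 2 ≤ t := by linarith [(abs_le.1 hδt).1]
  have ht2 : t ≤ 3 / 2 * t₁ := by linarith [(abs_le.1 hδt).2]
  have hr0 : 0 < r := by linarith
  have ht0 : 0 < t := by linarith
  have hγ1 : 3 / 4 ≤ z + r * dz := by linarith [(abs_le.1 hz).1, (abs_le.1 hdz).1]
  have hγ2 : z + r * dz ≤ 5 / 4 := by linarith [(abs_le.1 hz).2, (abs_le.1 hdz).2]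
  refine ⟨by linarith, by linarith, ?_, ?_, ?_⟩
  · -- `K/(4U) · r ≤ (3/8) K c³/U ≤ (3/8) K c² ≤ t (z + r ζ')`
    rw [le_div_iff₀ hr0]
    have h1 : K / (4 * U) * r ≤ K / (4 * U) * (3 / 2 * c ^ 3) :=
      mul_le_mul_of_nonneg_left (by rw [← hr₁]; exact hr2) (by positivity)
    have h2 : K / (4 * U) * (3 / 2 * c ^ 3) ≤ 3 / 8 * K * c ^ 2 := by
      rw [div_mul_eq_mul_div, div_le_iff₀ (by positivity)]
      nlinarith [mul_le_mul_of_nonneg_left hcU (by positivity : (0:ℝ) ≤ K * c ^ 2)]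
    have h3 : 3 / 8 * K * c ^ 2 ≤ t * (z + r * dz) := by
      calc 3 / 8 * K * c ^ 2 = (K * c ^ 2 / 2) * (3 / 4) := by ring
        _ ≤ t * (z + r * dz) := mul_le_mul (by rw [← ht₁]; exact ht1) hγ1 (by norm_num) ht0.le
    linarith
  · -- `t (z + r ζ') ≤ (3/2) K c² (5/4) ≤ 4K/L · r` since `r ≥ c³/2 ≥ L c²/2`
    rw [div_le_iff₀ hr0]
    have h1 : t * (z + r * dz) ≤ 3 / 2 * (K * c ^ 2) * (5 / 4) :=
      mul_le_mul (by rw [← ht₁]; exact ht2) hγ2 (by linarith) (by positivity)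
    have h2 : 4 * K / L * (c ^ 3 / 2) ≤ 4 * K / L * r :=
      mul_le_mul_of_nonneg_left (by rw [← hr₁]; exact hr1) (by positivity)
    have h3 : 3 / 2 * (K * c ^ 2) * (5 / 4) ≤ 4 * K / L * (c ^ 3 / 2) := by
      rw [show 4 * K / L * (c ^ 3 / 2) = 2 * K * c ^ 2 * (c / L) by field_simp; ring]
      have : 1 ≤ c / L := (one_le_div hL).2 hLc
      nlinarith [mul_le_mul_of_nonneg_left this (by positivity : (0:ℝ) ≤ 2 * K * c ^ 2)]
    linarith
  · -- `L/(2K) · t ≤ (3/4) L c² ≤ (3/4) c³ = (3/4) r₁ ≤ (3/2) r`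
    rw [le_div_iff₀ ht0]
    have h1 : L / (2 * K) * t ≤ L / (2 * K) * (3 / 2 * (K * c ^ 2)) :=
      mul_le_mul_of_nonneg_left (by rw [← ht₁]; exact ht2) (by positivity)
    have h2 : L / (2 * K) * (3 / 2 * (K * c ^ 2)) = 3 / 4 * (L * c ^ 2) := by
      field_simp; ring
    have h3 : L * c ^ 2 ≤ c ^ 3 := by nlinarith [mul_le_mul_of_nonneg_right hLc (sq_nonneg c)]
    nlinarith

/-- `a ≤ b` from `a² ≤ b²` for `a, b ≥ 0`. [folklore] -/
theorem lbClose_le_of_sq_le {a b : ℝ} (ha : 0 ≤ a) (hb : 0 ≤ b) (h : a ^ 2 ≤ b ^ 2) : a ≤ b := by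
  have h' := abs_le_of_sq_le_sq h hb
  rwa [abs_of_nonneg ha] at h'

/-- Linearity of the torus partial derivative on differences of `C¹` functions, applied form.
[folklore] -/
theorem lbClose_partialDeriv_sub {F : Type} [NormedAddCommGroup F] [NormedSpace ℝ F]
    {a b : T3 → F} (ha : Torus.IsContDiff 1 a) (hb : Torus.IsContDiff 1 b) (i : Fin 3) (x : T3) :
    Torus.partialDeriv i (fun y => a y - b y) x = Torus.partialDeriv i a x - Torus.partialDeriv i b x := by
  have h := (Torus.hasDerivAt_comp_add_proj_smul ha x (EuclideanSpace.single i (1 : ℝ)) 0).sub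
    (Torus.hasDerivAt_comp_add_proj_smul hb x (EuclideanSpace.single i (1 : ℝ)) 0)
  simp only [zero_smul, Torus.proj_zero, add_zero] at h
  exact h.deriv

/-! ### The improvement step -/

/-- **Improvement step.** There is `K_S > 0` such that: for a σ-solution `(ρ, u, θ)` (law `ζ` smooth on
an open `J ∋ ρ`) and an isentropic reference `(ρ₁, u₁, θ₁)` (`θ₁ = Kρ₁^{2/3}`) on `[0, T)`, at a time
`s ∈ [0, T)`, `s < T₁`, with envelope `L ≤ ρ₁^{1/3} ≤ U` (`0 < L ≤ 1 ≤ U`), WEAK bounds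
`|δρ| ≤ ρ₁/2`, `|δθ| ≤ θ₁/2`, `ρσ³ ≤ ηs`, packing-proportional law bounds with `cZ ηs ≤ 1/8`, level
energies `≤ ℰ` and the seven smallness inequalities of `lbClose_smallness`, the STRONG bounds hold at
`s`: `|δρ| ≤ ρ₁/4`, `|δθ| ≤ θ₁/4`, `ρσ³ ≤ ηs/2`, `‖δu‖ ≤ 1`, and
`‖∂ᵢδu‖, √θ₁|∂ᵢδρ|/ρ₁, |∂ᵢδθ|/√θ₁ ≤ 1/(2(T₁ - s))`. [folklore] -/
theorem lbClose_step :
    ∃ KS : ℝ, 0 < KS ∧ ∀ {σ T : ℝ} {ρ θ ρ₁ θ₁ : ℝ → T3 → ℝ} {u u₁ : ℝ → T3 → V3} {ζ : ℝ → ℝ}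
      {J : Set ℝ} {s K L U ℰ cZ ηs T₁ : ℝ},
      IsHardSphereEulerSolution σ T ρ u θ → IsHardSphereEulerSolution 0 T ρ₁ u₁ θ₁ → IsOpen J →
      ContDiffOn ℝ (⊤ : ℕ∞) ζ J → (∀ t ∈ Ico 0 T, ∀ x, ρ t x ∈ J) → s ∈ Ico 0 T → 0 < σ →
      0 < K → 0 < L → L ≤ 1 → 1 ≤ U → 0 ≤ cZ → cZ * ηs ≤ 1 / 8 → 0 < T₁ → s < T₁ →
      (∀ x, θ₁ s x = K * ρ₁ s x ^ (2 / 3 : ℝ)) →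
      (∀ x, L ≤ ρ₁ s x ^ (1 / 3 : ℝ) ∧ ρ₁ s x ^ (1 / 3 : ℝ) ≤ U) →
      (∀ x, |ρ s x - ρ₁ s x| ≤ ρ₁ s x / 2 ∧ |θ s x - θ₁ s x| ≤ θ₁ s x / 2 ∧ ρ s x * σ ^ 3 ≤ ηs) →
      (∀ x, |ζ (ρ s x) - 1| ≤ cZ * (ρ s x * σ ^ 3) ∧
        |ρ s x * deriv ζ (ρ s x)| ≤ cZ * (ρ s x * σ ^ 3)) →
      shadowE0 ζ ρ θ u ρ₁ θ₁ u₁ s ≤ ℰ → shadowE1 ζ ρ θ u ρ₁ θ₁ u₁ s ≤ ℰ →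
      shadowE2 ζ ρ θ u ρ₁ θ₁ u₁ s ≤ ℰ → shadowE3 ζ ρ θ u ρ₁ θ₁ u₁ s ≤ ℰ →
      KS * (4 * U / K) * (6 * ℰ) ≤ (L ^ 3 / 4) ^ 2 →
      KS * (2 * K / L) * (6 * ℰ) ≤ (K * L ^ 2 / 4) ^ 2 →
      3 / 2 * U ^ 3 * σ ^ 3 ≤ ηs / 2 →
      KS * (2 / L ^ 3) * (6 * ℰ) ≤ 1 →
      KS * (2 / L ^ 3) * (6 * ℰ) ≤ (1 / (2 * T₁)) ^ 2 →
      K / L ^ 4 * (KS * (4 * U / K) * (6 * ℰ)) ≤ (1 / (2 * T₁)) ^ 2 →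
      1 / (K * L ^ 2) * (KS * (2 * K / L) * (6 * ℰ)) ≤ (1 / (2 * T₁)) ^ 2 →
      ∀ x, |ρ s x - ρ₁ s x| ≤ ρ₁ s x / 4 ∧ |θ s x - θ₁ s x| ≤ θ₁ s x / 4 ∧
        ρ s x * σ ^ 3 ≤ ηs / 2 ∧ ‖u s x - u₁ s x‖ ≤ 1 ∧
        ∀ i : Fin 3,
          ‖Torus.partialDeriv i (u s) x - Torus.partialDeriv i (u₁ s) x‖ ≤ 1 / (2 * (T₁ - s)) ∧
          Real.sqrt (θ₁ s x) * |Torus.partialDeriv i (ρ s) x - Torus.partialDeriv i (ρ₁ s) x| /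
              ρ₁ s x ≤ 1 / (2 * (T₁ - s)) ∧
          |Torus.partialDeriv i (θ s) x - Torus.partialDeriv i (θ₁ s) x| / Real.sqrt (θ₁ s x) ≤
            1 / (2 * (T₁ - s)) := by
  obtain ⟨KS, hKS, SUP⟩ := lbClose_sup_bounds
  refine ⟨KS, hKS, ?_⟩
  intro σ T ρ θ ρ₁ θ₁ u u₁ ζ J s K L U ℰ cZ ηs T₁ hE hE₁ hJ hζ hρJ hs hσ hK hL hL1 hU hcZ hcη hT₁ hsT
    hisen henv hweak heos h0 h1 h2 h3 rS0a rS0b rS0c rS0d rS1a rS1b rS1c x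
  have hU0 : 0 < U := one_pos.trans_le hU
  have hσ3 : 0 ≤ σ ^ 3 := by positivity
  -- pointwise facts at every `y`
  have hP : ∀ y, 0 < ρ₁ s y ^ (1 / 3 : ℝ) ∧ ρ₁ s y = (ρ₁ s y ^ (1 / 3 : ℝ)) ^ 3 ∧
      θ₁ s y = K * (ρ₁ s y ^ (1 / 3 : ℝ)) ^ 2 ∧
      Real.sqrt (θ₁ s y) = Real.sqrt K * ρ₁ s y ^ (1 / 3 : ℝ) := fun y =>
    isentropic_pointwise_algebra hK (hE₁.density_pos s hs y) (hisen y)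
  have hsmall : ∀ y, |ζ (ρ s y) - 1| ≤ 1 / 8 ∧ |ρ s y * deriv ζ (ρ s y)| ≤ 1 / 8 := by
    intro y
    have hp : cZ * (ρ s y * σ ^ 3) ≤ 1 / 8 :=
      (mul_le_mul_of_nonneg_left (hweak y).2.2 hcZ).trans hcη
    exact ⟨(heos y).1.trans hp, (heos y).2.trans hp⟩
  have hF : ∀ y, L ^ 3 / 2 ≤ ρ s y ∧ ρ s y ≤ 3 / 2 * U ^ 3 ∧ K / (4 * U) ≤ shadowWeightA ζ ρ θ s y ∧
      shadowWeightA ζ ρ θ s y ≤ 4 * K / L ∧ L / (2 * K) ≤ shadowWeightB ρ θ s y := fun y =>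
    lbClose_point_facts hK hL (henv y).1 (henv y).2 (hP y).2.1 (hP y).2.2.1 (hweak y).1
      (hweak y).2.1 (hsmall y).1 (hsmall y).2
  -- the six squared sup bounds
  have hmA : (0 : ℝ) < K / (4 * U) := by positivity
  have hmρ : (0 : ℝ) < L ^ 3 / 2 := by positivity
  have hmB : (0 : ℝ) < L / (2 * K) := by positivity
  obtain ⟨bρ, bu, bθ, bgrad⟩ := SUP hE hE₁ hJ hζ hρJ hs hmA hmρ hmB (fun y => (hF y).2.2.1)
    (fun y => (hF y).1) (fun y => (hF y).2.2.2.2) h0 h1 h2 h3 x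
  simp only [inv_div] at bρ bu bθ bgrad
  -- reference algebra at `x`
  obtain ⟨hc, hρ₁c, hθ₁c, hsq⟩ := hP x
  set c : ℝ := ρ₁ s x ^ (1 / 3 : ℝ) with hc_def
  have hLc : L ≤ c := (henv x).1
  have hcU : c ≤ U := (henv x).2
  have hc3 : L ^ 3 ≤ c ^ 3 := pow_le_pow_left₀ hL.le hLc 3
  have hc2 : L ^ 2 ≤ c ^ 2 := pow_le_pow_left₀ hL.le hLc 2
  have hρ₁0 : 0 < ρ₁ s x := hE₁.density_pos s hs x
  have hθ₁0 : 0 < θ₁ s x := by rw [hθ₁c]; positivity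
  have hls : 0 < T₁ - s := by linarith
  have hstep : 1 / (2 * T₁) ≤ 1 / (2 * (T₁ - s)) :=
    one_div_le_one_div_of_le (by positivity) (by linarith [hs.1])
  have hT2 : (0 : ℝ) ≤ 1 / (2 * T₁) := by positivity
  -- smoothness of the slices (for the linearity of `∂ᵢ`)
  obtain ⟨sρ, su, sθ⟩ := isHardSphereEulerSolution_isSmooth_slice hE hs
  obtain ⟨sρ₁, su₁, sθ₁⟩ := isHardSphereEulerSolution_isSmooth_slice hE₁ hs
  refine ⟨?_, ?_, ?_, ?_, fun i => ⟨?_, ?_, ?_⟩⟩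
  · -- `|δρ| ≤ L³/4 ≤ ρ₁/4`
    have h : |ρ s x - ρ₁ s x| ≤ L ^ 3 / 4 :=
      abs_le_of_sq_le_sq (bρ.trans rS0a) (by positivity)
    have h' : L ^ 3 / 4 ≤ ρ₁ s x / 4 := by rw [hρ₁c]; linarith
    exact h.trans h'
  · have h : |θ s x - θ₁ s x| ≤ K * L ^ 2 / 4 :=
      abs_le_of_sq_le_sq (bθ.trans rS0b) (by positivity)
    have h' : K * L ^ 2 / 4 ≤ θ₁ s x / 4 := by
      rw [hθ₁c]; nlinarith [mul_le_mul_of_nonneg_left hc2 hK.le]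
    exact h.trans h'
  · calc ρ s x * σ ^ 3 ≤ 3 / 2 * U ^ 3 * σ ^ 3 := mul_le_mul_of_nonneg_right (hF x).2.1 hσ3
      _ ≤ ηs / 2 := rS0c
  · exact lbClose_le_of_sq_le (norm_nonneg _) zero_le_one (by rw [one_pow]; exact bu.trans rS0d)
  · rw [← lbClose_partialDeriv_sub (su.isContDiff (by simp)) (su₁.isContDiff (by simp)) i x]
    exact (lbClose_le_of_sq_le (norm_nonneg _) hT2 ((bgrad i).2.1.trans rS1a)).trans hstep
  · rw [← lbClose_partialDeriv_sub (sρ.isContDiff (by simp)) (sρ₁.isContDiff (by simp)) i x]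
    set d : ℝ := Torus.partialDeriv i (fun y => ρ s y - ρ₁ s y) x with hd
    have hd2 : d ^ 2 ≤ KS * (4 * U / K) * (6 * ℰ) := (bgrad i).1
    have hnn : 0 ≤ Real.sqrt (θ₁ s x) * |d| / ρ₁ s x := by positivity
    refine (lbClose_le_of_sq_le hnn hT2 ?_).trans hstep
    have hc4 : L ^ 4 ≤ c ^ 4 := pow_le_pow_left₀ hL.le hLc 4
    calc (Real.sqrt (θ₁ s x) * |d| / ρ₁ s x) ^ 2 = K * d ^ 2 / c ^ 4 := by
          rw [hsq, hρ₁c, div_pow, mul_pow, mul_pow, Real.sq_sqrt hK.le, sq_abs]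
          field_simp
      _ ≤ K * d ^ 2 / L ^ 4 := div_le_div_of_nonneg_left (by positivity) (by positivity) hc4
      _ = K / L ^ 4 * d ^ 2 := by ring
      _ ≤ K / L ^ 4 * (KS * (4 * U / K) * (6 * ℰ)) := mul_le_mul_of_nonneg_left hd2 (by positivity)
      _ ≤ (1 / (2 * T₁)) ^ 2 := rS1b
  · rw [← lbClose_partialDeriv_sub (sθ.isContDiff (by simp)) (sθ₁.isContDiff (by simp)) i x]
    set d : ℝ := Torus.partialDeriv i (fun y => θ s y - θ₁ s y) x with hd
    have hd2 : d ^ 2 ≤ KS * (2 * K / L) * (6 * ℰ) := (bgrad i).2.2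
    have hnn : 0 ≤ |d| / Real.sqrt (θ₁ s x) := by positivity
    refine (lbClose_le_of_sq_le hnn hT2 ?_).trans hstep
    have hsK : 0 < Real.sqrt K := Real.sqrt_pos.2 hK
    calc (|d| / Real.sqrt (θ₁ s x)) ^ 2 = d ^ 2 / (K * c ^ 2) := by
          rw [hsq, div_pow, mul_pow, Real.sq_sqrt hK.le, sq_abs]
      _ ≤ d ^ 2 / (K * L ^ 2) :=
          div_le_div_of_nonneg_left (sq_nonneg _) (by positivity)
            (mul_le_mul_of_nonneg_left hc2 hK.le)
      _ = 1 / (K * L ^ 2) * d ^ 2 := by ring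
      _ ≤ 1 / (K * L ^ 2) * (KS * (2 * K / L) * (6 * ℰ)) :=
          mul_le_mul_of_nonneg_left hd2 (by positivity)
      _ ≤ (1 / (2 * T₁)) ^ 2 := rS1c

end Summit.AtomisticToContinuum.HydrodynamicLimit.Theorems

end
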